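import Literature.MathematicalPhysics.QuantumFieldTheory.Balaban1983to89.B5Prop11Plancherel
import HarnessLib

/-!
# Route `UnitScaleTilt`, crux K1 «MinimiserStabilityRegPr» (stmt-QuantumFields-19200), EX row `hGF` — the SMALL-MEMBER branch of the curved target `hT`, exit (α)(a) brick (1) —
# **TWISTED FOURIER MULTIPLIERS: AT A CONSTANT ABELIAN BACKGROUND (A TORON AFTER A GLOBAL GAUGE) THE COVARIANT TRANSLATIONS, FORWARD DIFFERENCES AND STRAIGHT-CONTOUR SUMS
# ARE STILL DIAGONALISED BY THE STANDARD DFT OF lit `B5Prop11Plancherel` — ONLY THE SYMBOL SHIFTS, BY A REAL MOMENTUM**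

Cell `ym3-torus` (HUMAN RULING D-0037: YM₃ on T³ is ladder rung R3 — NOT d = 4, NOT infinite volume, NOT a mass gap, NOT Clay).  Width seat `ym3-torus-px10` (gen 10);
★★OWNER WORD 79 (a) «px10: GO (α)(a)-1» on LOCATE-SMALL-MEMBERS (19200 evidence #57∕#59).  THEOREMS ONLY (0 `def`, 0 `sorry`): the twisted operators are written INLINE as the
explicit matrices `ω • shiftM N ν`, `c • (ω • shiftM N ν − 1)`, `Σ_{t<m} (ω • shiftM N ν)^t` in the letters of lit ✓`B5Prop11Plancherel` (`Tor`, `chi`, `dft`, `dftV`, `shiftM`,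
`unitVec`, `emb`, `sOf`, `fine`) and lit ✓`B5Prop11Fiber` (`dSym`); `--supports stmt-QuantumFields-19200 --as helper`, count-neutral.  HONEST LABEL (★★OWNER RULING №33 (6)):
finite-torus Fourier bookkeeping; nothing of the twisted coercivity (bricks (2)–(3)), of `hT`, `hGF`, EX or the crux is proved here.

WHY (LOCATE-SMALL-MEMBERS §(vi)).  The (L6) knit of the LOD line certifies `hT` only for members whose coarse torus admits the IMS cubes; on the remaining small members
`RegPr` still admits torons, i.e. after a global gauge a CONSTANT ABELIAN background `U(x, ν) = g_ν = e^{iθ_ν σ₃}` (commuting SU(2) holonomies `h_ν = g_ν^{N_ν}` lie in one maximal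
torus).  On the charged sectors `σ_±` of `su(2) ⊗ ℂ` the covariant translation is `(S^ω_ν f)(x) = ω_ν·f(x + e_ν)` with the CONSTANT unit `ω_ν = e^{±2iθ_ν}` — and `ω_ν^{N_ν} = h_ν^{±2}`
need NOT be `1`, which is exactly why a toron is not a gauge copy of `U = 1`.  Nevertheless the standard characters `x ↦ e^{ip·x}` (`p` on the dual LATTICE) remain eigenvectors:
`S^ω_ν e^{ip·x} = ω_ν e^{ip_ν} e^{ip·x}`.  So every translation-covariant operator built from the `S^ω_ν` — forward differences `c(ω_ν S_ν − 1)`, their adjoints, straight-contour sums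
`Σ_{t<m}(ω_ν S_ν)^t` (the building block of the `k`-fold averages (1.18)∕(1.61)) — is, in the SAME unitary `dftV` of ✓`B5Prop11Plancherel`, a diagonal multiplier whose symbol is the
flat symbol at the SHIFTED REAL momentum `p + θ`: on the coset parametrisation `emb` of the fine torus `fine n M` the twisted difference symbol is lit `B5Prop11Fiber.dSym n k (sOf M q + n•φ) ν`
(§3) — so the fibre bounds of ✓`B5Prop11Fiber`, stated for ARBITRARY real momenta, apply verbatim (brick (2)).

WHAT IS PROVED (ns `…Theorems.ToronTwistedMultipliers`; any dimension `d`, any torus sizes `N`).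
* §1 `diagonal_smul_fun` (bookkeeping), ★`dftV_mul_twistedShift` (`U(ωS_ν) = diag(ω·e^{2πip_ν∕N_ν})U`), ★`dftV_mul_twistedShift_pow` (powers: symbol `(ω·e^{ip_ν})^t`),
  ★★`dftV_mul_twistedDiff` (`U·c(ωS_ν − 1) = diag(c(ω e^{ip_ν} − 1))·U`), `twistedDiff_eq` ∕ `star_twistedDiff_eq` (`= U^* diag U`, the shape ✓`opNorm_le_of_blocks` consumes),
  ★★`dftV_mul_twistedSegSum` (straight-contour sums `Σ_{t<m}(ωS_ν)^t`: symbol `Σ_{t<m}(ω e^{ip_ν})^t`).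
* §2 `norm_stdAddChar_eq_one` (`‖e^{ip_ν}‖ = 1`), ★`norm_twistedSymbol_sq` (for `‖ω‖ = 1` the twisted symbol has the FLAT modulus law `‖ω e^{ip_ν} − 1‖² = 2 − 2·Re(ω e^{ip_ν})`) and
  `norm_twistedSymbol_le_two` (`‖ω e^{ip_ν} − 1‖ ≤ 2`).
* §3 ★★★`twistedSym_emb` — THE SHIFT IDENTITY on the coset parametrisation of lit §4: for a twist `ω_ν = exp(i φ_ν)`,
  `n·(ω_ν·χ(emb((k,μ),q))_ν − 1) = dSym n k (sOf M q + n•φ) ν` — the twisted symbol IS the flat symbol of (1.31)∕(1.83) at the real momentum `p′ + nφ`.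
HONEST SCOPE.  Matrix identities on the finite torus; no estimate of print; the sector decomposition of the member's operators at a constant abelian background (which makes these the
member's letters) and the twisted fibre∕block bounds are bricks (2)–(4), NOT here.

References: T. Bałaban, CMP **95** (1984) 17–40 [Balaban1984PropagatorsI] ((1.18) p.20, (1.29)–(1.31) p.23, (1.61) p.28, (1.83) p.31, Prop. 1.1 (1.89) p.33);
CMP **99** (1985) 389–434 [Balaban1985BackgroundPropagators] (Thm 3.11 p.416 — the curved target whose small-member branch this serves).
-/

set_option autoImplicit false

noncomputable section

open scoped BigOperators Matrix ComplexConjugate Matrix.Norms.L2Operator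
open Finset Complex

namespace Summit.QuantumFields.YangMills.Theorems.ToronTwistedMultipliers

open Literature.MathematicalPhysics.QuantumFieldTheory.Balaban1983to89.B5Prop11Plancherel
open Literature.MathematicalPhysics.QuantumFieldTheory.Balaban1983to89.B5Prop11Fiber (dSym)
open Literature.MathematicalPhysics.QuantumFieldTheory.Balaban1983to89.B4Strip (shiftr)

/-! ## §1 The twisted translation, difference and contour sum are standard Fourier multipliers -/

section Multipliers

variable {d : ℕ} (N : Fin d → ℕ) [hN : ∀ μ, NeZero (N μ)]

/-- `ω • diag(f) = diag(ω·f)`. [folklore] -/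
theorem diagonal_smul_fun {m : Type*} [Fintype m] [DecidableEq m] (ω : ℂ) (f : m → ℂ) :
    ω • Matrix.diagonal f = Matrix.diagonal (fun i => ω * f i) := by
  ext i j
  by_cases h : i = j
  · subst h; simp
  · simp [h]

/-- ★ **THE TWISTED TRANSLATION IS DIAGONAL IN THE STANDARD DFT**: `U·(ω S_ν) = diag(ω·e^{2πi p_ν∕N_ν})·U` — the characters stay eigenvectors, the eigenvalue is multiplied by the
constant phase `ω` (✓`dftV_mul_shiftM`). [cite: Balaban1984PropagatorsI, (1.29)-(1.31) p.23] -/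
theorem dftV_mul_twistedShift (ω : ℂ) (ν : Fin d) :
    dftV N * (ω • shiftM N ν)
      = Matrix.diagonal (fun i : Tor N × Fin d => ω * (ZMod.stdAddChar (N := N ν)) (i.1 ν)) * dftV N := by
  rw [Matrix.mul_smul, dftV_mul_shiftM, ← Matrix.smul_mul, diagonal_smul_fun]

/-- ★ Powers of the twisted translation: `U·(ω S_ν)^t = diag((ω·e^{2πi p_ν∕N_ν})^t)·U`. [cite: Balaban1984PropagatorsI, (1.18) p.20, (1.31) p.23] -/
theorem dftV_mul_twistedShift_pow (ω : ℂ) (ν : Fin d) (t : ℕ) :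
    dftV N * (ω • shiftM N ν) ^ t
      = Matrix.diagonal (fun i : Tor N × Fin d => (ω * (ZMod.stdAddChar (N := N ν)) (i.1 ν)) ^ t) * dftV N := by
  induction t with
  | zero =>
    rw [pow_zero, Matrix.mul_one]
    have h : (Matrix.diagonal fun i : Tor N × Fin d => (ω * (ZMod.stdAddChar (N := N ν)) (i.1 ν)) ^ 0) = 1 := by
      simp only [pow_zero]; exact Matrix.diagonal_one
    rw [h, Matrix.one_mul]
  | succ t ih =>
    rw [pow_succ, ← Matrix.mul_assoc, ih, Matrix.mul_assoc, dftV_mul_twistedShift, ← Matrix.mul_assoc, Matrix.diagonal_mul_diagonal]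
    simp only [pow_succ]

/-- ★★ **THE TWISTED FORWARD DIFFERENCE IS A FOURIER MULTIPLIER**: `U·c(ω S_ν − 1) = diag(c(ω e^{2πi p_ν∕N_ν} − 1))·U` — the flat `fdiff`∕`fsym` pair of lit §3 with the symbol
evaluated at the shifted momentum. [cite: Balaban1984PropagatorsI, (1.31) p.23] -/
theorem dftV_mul_twistedDiff (c ω : ℂ) (ν : Fin d) :
    dftV N * (c • (ω • shiftM N ν - 1))
      = Matrix.diagonal (fun i : Tor N × Fin d => c * (ω * (ZMod.stdAddChar (N := N ν)) (i.1 ν) - 1)) * dftV N := by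
  rw [Matrix.mul_smul, Matrix.mul_sub, Matrix.mul_one, dftV_mul_twistedShift]
  have h : Matrix.diagonal (fun i : Tor N × Fin d => c * (ω * (ZMod.stdAddChar (N := N ν)) (i.1 ν) - 1))
      = c • (Matrix.diagonal (fun i : Tor N × Fin d => ω * (ZMod.stdAddChar (N := N ν)) (i.1 ν)) - 1) := by
    ext i j
    by_cases hij : i = j
    · subst hij; simp
    · simp [hij]
  rw [h, Matrix.smul_mul, Matrix.sub_mul, Matrix.one_mul]

/-- `c(ω S_ν − 1) = U^* diag(c(ω e^{ip_ν} − 1)) U` — the shape ✓`opNorm_le_of_blocks`∕✓`opNorm_unitary_conj` consume. [cite: Balaban1984PropagatorsI, (1.31) p.23] -/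
theorem twistedDiff_eq (c ω : ℂ) (ν : Fin d) :
    c • (ω • shiftM N ν - 1)
      = star (dftV N) * Matrix.diagonal (fun i : Tor N × Fin d => c * (ω * (ZMod.stdAddChar (N := N ν)) (i.1 ν) - 1)) * dftV N := by
  rw [Matrix.mul_assoc, ← dftV_mul_twistedDiff, ← Matrix.mul_assoc, star_dftV_mul, Matrix.one_mul]

/-- The adjoint twisted difference: `(c(ω S_ν − 1))^* = U^* diag(conj(c(ω e^{ip_ν} − 1))) U`. [cite: Balaban1984PropagatorsI, (1.31) p.23] -/
theorem star_twistedDiff_eq (c ω : ℂ) (ν : Fin d) :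
    star (c • (ω • shiftM N ν - 1))
      = star (dftV N) * Matrix.diagonal (star fun i : Tor N × Fin d => c * (ω * (ZMod.stdAddChar (N := N ν)) (i.1 ν) - 1)) * dftV N := by
  rw [twistedDiff_eq, star_mul, star_mul, star_star, ← Matrix.mul_assoc, Matrix.star_eq_conjTranspose,
    Matrix.star_eq_conjTranspose (Matrix.diagonal _), Matrix.diagonal_conjTranspose, ← Matrix.star_eq_conjTranspose]

/-- ★★ **THE TWISTED STRAIGHT-CONTOUR SUM IS A FOURIER MULTIPLIER**: `U·Σ_{t<m}(ω S_ν)^t = diag(Σ_{t<m}(ω e^{ip_ν})^t)·U` — the building block of the covariant `k`-fold averages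
(1.18)∕(1.61) along a straight contour of `m` bonds at a constant abelian background. [cite: Balaban1984PropagatorsI, (1.18) p.20, (1.61) p.28] -/
theorem dftV_mul_twistedSegSum (ω : ℂ) (ν : Fin d) (m : ℕ) :
    dftV N * (∑ t ∈ Finset.range m, (ω • shiftM N ν) ^ t)
      = Matrix.diagonal (fun i : Tor N × Fin d => ∑ t ∈ Finset.range m, (ω * (ZMod.stdAddChar (N := N ν)) (i.1 ν)) ^ t) * dftV N := by
  rw [Matrix.mul_sum, Finset.sum_congr rfl fun t _ => dftV_mul_twistedShift_pow N ω ν t, ← Finset.sum_mul]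
  congr 1
  ext i j
  by_cases h : i = j
  · subst h; simp [Matrix.diagonal_apply_eq, Matrix.sum_apply]
  · simp [Matrix.sum_apply, h]

end Multipliers

/-! ## §2 Sizes: the twisted symbol has the flat modulus law -/

section Sizes

variable {d : ℕ} (N : Fin d → ℕ) [hN : ∀ μ, NeZero (N μ)]

/-- The character values are units: `‖e^{2πi p_ν∕N_ν}‖ = 1`. [folklore] -/
theorem norm_stdAddChar_eq_one {M : ℕ} [NeZero M] (a : ZMod M) : ‖(ZMod.stdAddChar (N := M)) a‖ = 1 := by
  rw [ZMod.stdAddChar_apply]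
  exact Circle.norm_coe _

/-- ★ **FLAT MODULUS LAW FOR THE TWISTED SYMBOL**: for a unit twist `‖ω‖ = 1`, `‖ω e^{ip_ν} − 1‖² = 2 − 2·Re(ω e^{ip_ν})` — the same law as the flat `|e^{ip} − 1|² = 2 − 2cos p`, at
the shifted phase. [cite: Balaban1984PropagatorsI, (1.31) p.23] -/
theorem norm_twistedSymbol_sq {ω : ℂ} (hω : ‖ω‖ = 1) (p : Tor N) (ν : Fin d) :
    ‖ω * (ZMod.stdAddChar (N := N ν)) (p ν) - 1‖ ^ 2 = 2 - 2 * (ω * (ZMod.stdAddChar (N := N ν)) (p ν)).re := by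
  set z : ℂ := ω * (ZMod.stdAddChar (N := N ν)) (p ν) with hz
  have hz1 : ‖z‖ = 1 := by rw [hz, norm_mul, hω, norm_stdAddChar_eq_one, one_mul]
  have h1 : ‖z - 1‖ ^ 2 = ‖z‖ ^ 2 - 2 * z.re + 1 := by
    rw [Complex.sq_norm, Complex.sq_norm, Complex.normSq_apply, Complex.normSq_apply]
    simp only [Complex.sub_re, Complex.one_re, Complex.sub_im, Complex.one_im, sub_zero]
    ring
  rw [h1, hz1]; ring

/-- The twisted symbol is bounded by `2` for a unit twist: `‖ω e^{ip_ν} − 1‖ ≤ 2`. [folklore] -/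
theorem norm_twistedSymbol_le_two {ω : ℂ} (hω : ‖ω‖ = 1) (p : Tor N) (ν : Fin d) :
    ‖ω * (ZMod.stdAddChar (N := N ν)) (p ν) - 1‖ ≤ 2 := by
  calc ‖ω * (ZMod.stdAddChar (N := N ν)) (p ν) - 1‖ ≤ ‖ω * (ZMod.stdAddChar (N := N ν)) (p ν)‖ + ‖(1 : ℂ)‖ := norm_sub_le _ _
    _ = 2 := by rw [norm_mul, hω, norm_stdAddChar_eq_one, norm_one]; norm_num

end Sizes

/-! ## §3 ★★★ The shift identity on the coset parametrisation: twisted symbol = flat symbol at `p′ + nφ` -/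

section Shift

variable {d : ℕ} (n : ℕ) [NeZero n] (M : Fin d → ℕ) [hM : ∀ μ, NeZero (M μ)]

/-- ★★★ **THE SHIFT IDENTITY**: on the coset `p = p′ + l` of the fine torus `fine n M` (lit §4: `emb ((k, μ), q)`, `p′ = sOf M q`, `l = 2πk`), the symbol of the twisted forward
difference `n·(ω_ν S_ν − 1)` with unit twist `ω_ν = exp(i φ_ν)` equals the FLAT symbol `∂_ν(p′ + l)` of (1.31)∕(1.83) — lit `B5Prop11Fiber.dSym` — at the SHIFTED REAL momentum
`p′ + n•φ`: `n·(exp(iφ_ν)·e^{2πi j_ν∕(nM_ν)} − 1) = dSym n k (sOf M q + n•φ) ν`.  (The untwisted case `φ = 0` is lit ✓`fsym_emb`.) Hence every fibre bound of ✓`B5Prop11Fiber`,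
being stated for arbitrary real momenta, applies to the twisted operators. [cite: Balaban1984PropagatorsI, (1.31) p.23, (1.83) p.31] -/
theorem twistedSym_emb (φ : Fin d → ℝ) (k : Fin d → Fin n) (μ : Fin d) (q : Tor M) (ν : Fin d) :
    (n : ℂ) * (Complex.exp (((φ ν : ℝ) : ℂ) * I) * (ZMod.stdAddChar (N := fine n M ν)) ((emb n M ((k, μ), q)).1 ν) - 1)
      = dSym n k (sOf M q + fun ν' => (n : ℝ) * φ ν') ν := by
  have hMne : (M ν : ℂ) ≠ 0 := by exact_mod_cast NeZero.ne (M ν)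
  have hn : (n : ℂ) ≠ 0 := by exact_mod_cast NeZero.ne n
  unfold emb dSym shiftr sOf
  simp only [Pi.add_apply]
  rw [ZMod.stdAddChar_coe, ← Complex.exp_add]
  congr 3
  simp only [fine]
  push_cast
  field_simp
  ring

/-- The shift identity read as «the twisted symbol is a flat symbol»: for every coset index there is a real momentum `s` (namely `sOf M q + n•φ`) with
`n·(ω_ν χ_ν − 1) = dSym n k s ν` for ALL directions `ν` simultaneously. [cite: Balaban1984PropagatorsI, (1.31) p.23] -/
theorem exists_real_momentum_of_twist (φ : Fin d → ℝ) (k : Fin d → Fin n) (μ : Fin d) (q : Tor M) :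
    ∃ s : Fin d → ℝ, ∀ ν : Fin d,
      (n : ℂ) * (Complex.exp (((φ ν : ℝ) : ℂ) * I) * (ZMod.stdAddChar (N := fine n M ν)) ((emb n M ((k, μ), q)).1 ν) - 1) = dSym n k s ν :=
  ⟨sOf M q + fun ν' => (n : ℝ) * φ ν', fun ν => twistedSym_emb n M φ k μ q ν⟩

end Shift

end Summit.QuantumFields.YangMills.Theorems.ToronTwistedMultipliers

end
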